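/-
Copyright (c) 2026 the pub-hodgecm-mathlib formalisation cell (harness21).  Prover seat hodgecm-mathlib-K2E4-p14 (g2), Track B «K2-LIT» ∕ h413,
ENGINE E4 unit U6 `ArchLimitConstant`, socket #10♯ `sig_K2E4ExplicitArchConstantPhaseSigned` — LAST MILE, file (C) of the dealer's cut 2026-09-03T23:49:50Z:
the signed assembly's FRAME EXPORT ⟹ the γ₀-free SIGN LAW of ★ p855349.  2026-09-04.
-/
import Summits.HodgeConjecture.HodgeConjecture.Theorems.K2E4SingularPairArchKappaSign   -- ★ p855310 (K2E4-p15): the per-place ∕ global κ-sign law at a semiregular pair, `Δ‴_∞ = τ·D·Πκ‴`, `D > 0`, `τ̄τ = 1`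
import HarnessLib

/-!
# Socket #10♯, last mile (C): the signed #9 assembly's export `cinf = (−1)^{|W|}·(Π_w sgn σ_w(d₀d₁))·s·conj Δ‴_∞(γ_H ⊗ 1, γ₀′ ⊗ 1)` IS the sign law
# `cinf = ε(H′)·s′·conj τ_∞(γ_H ⊗ 1)`, `ε(H′) = Π_w(−sgn σ_w det H′)`, `s′ = s·D_∞ > 0` (Rogawski 1990, Prop. 8.2.1 proof p. 119 «differs by a sign»)

Cell `pub/hodgecm-mathlib`, crux H413 = `stmt-HodgeConjecture-24833`, route of record `HCCMUnconditional`; Track B «K2-LIT», line `K2_E4_SingularTransferKappaSign`,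
socket module `…SigsArchLimitConstant`, socket #10♯ (the only E4-internal leaf left under B_R ∕ #14 ∕ O7-by-value).  Dealer K2E4-plan (g0) cut 23:49:50Z: (A) K2E4-p09 = the
SIGNED assembly `…OfPackagesSigned` exporting, at its internal diagonal frame `(α′, P)` and torus point `t = t_{α′}(ẽ₁, ẽ₂, ẽ₁)`,
`cinf = (−1)^{|W|} · (Π_w sgn Re σ_w(α′₀α′₂)) · s · conj(Tinf.Δ h₀ (Φ_P t))`, `s > 0` (the `(−1)^{|W|}` from (b) ★ `C_w < 0` (K2E4-p13), the `Π sgn` from (c) ★ p855645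
`GPrimeDataSigned.lam_phase` (this seat)); (B) K2E4-p13 = `Φ_P t = cmRationalToArch L 3 H′ γ₀′` for the RATIONAL semiregular element `γ₀′ = P·diag(e₁,e₂,e₁)·P⁻¹` with its
pinned frame `(P∘(0 2 1), d = (α′₀, α′₂, α′₁))`, and `h₀ = γ_H ⊗ 1`; (C) THIS FILE = the conversion into the hypothesis of ★ p855349
`explicitArchConstantPhaseSigned_of_signLaw` (K2E4-p15): `∃ s′ > 0, cinf = ε(H′)·s′·conj τ_∞(γ_H ⊗ 1)`.  THEOREMS ONLY (no `def`, no `instance`, no notation, no `sorry`);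
lane `--supports stmt-HodgeConjecture-24833 --as helper`.

THE MATHEMATICS (all over ★ p855310's frame algebra at the semiregular rational element `γ₀′` with a pinned diagonal frame `(P, d)`: `ᵗ(cP)H′P = diag d`,
`γ₀′P = P·diag(e₁,e₁,e₂)`, `σ dᵢ = dᵢ ≠ 0`):
* §1 `neg_one_pow_card_mul_prod_sign_eq` — `(−1)^{|W|} · Π_w sgn Re σ_w(d₀d₁) = (−1)^{N(γ₀′)}`, `N = #{w ∣ ∞ : W₂(γ₀′) ⊗_w ℂ definite}`: per place `sgn σ_w(d₀d₁) = +1` iff the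
  `e₁`-plane is definite (★ `eigenplane_anisotropic_arch_iff`), so `Π sgn = (−1)^{#indefinite}` and `|W| = #definite + #indefinite`.
* §2 `prod_neg_sign_det_mul_self` — `ε(H′)·ε(H′) = 1` (each `sgn σ_w det H′ = sgn d₀ sgn d₁ sgn d₂ ≠ 0`, ★ `sign_re_embedding_det_of_frame`).
* §3 **`signLaw_of_frameExport`** — with ★ `archCanonicalDelta_singularPair_eq` (`Δ‴_∞(γ_H⊗1, γ₀′⊗1) = τ·D·K`, `K = Π_w κ‴_w`), ★ `archWeylRatio_singularPair_pos` (`D > 0`) and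
  ★ `prod_neg_sign_det_mul_prod_archKappaSignAt_eq_neg_one_pow_ncard` (`ε·K = (−1)^N`): `cinf = (−1)^N·s·conj(τ·D·K) = (−1)^N·s·D·K·conj τ = ε·(εK)·(−1)^N·s·D·conj τ
  = ε·(s·D)·conj τ` (`ε² = 1`, `((−1)^N)² = 1`).  So the EXPORT SHAPE IS RIGHT AS TYPED and #10♯ is TRUE as typed (r02's #10♯-abs PASS 23:17:03Z, independently).
HONEST LABEL: HC_CM is proved only modulo the 7 printed citations (2 remaining named inputs: hLiu418 = stmt-HodgeConjecture-24832, h413 = stmt-HodgeConjecture-24833) until rung 0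
closes; count-neutral helper — #10♯ closes BY NAME as ★ p855349 ∘ (C) ∘ (B) ∘ (A) in `Theorems/K2E4ExplicitArchConstantPhaseSigned.lean` (this seat assembles, dealer's cut).

## References
* [Rogawski1990] J. D. Rogawski, *Automorphic Representations of Unitary Groups in Three Variables*, Ann. of Math. Stud. 123 (1990): §8.2 Prop. 8.2.1 (a) p. 118 and its proof
  pp. 118–119 (held e-text book:rogawski1990 p0118.txt:L32 «the constant in the limit formula for H′ differs by a sign from that in the limit formula for H», L36
  «τ(γ)|A₁(γ)A₂(γ)|»); §4.9 p. 55; §14.6 p. 242; §8.2 p. 117.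
* [Kottwitz1983] R. E. Kottwitz, *Sign changes in harmonic analysis on reductive groups*, Trans. Amer. Math. Soc. 278 (1983), §1.
* [LanglandsShelstad1987] R. P. Langlands, D. Shelstad, *On the definition of transfer factors*, Math. Ann. 278 (1987), §2, §6.4.
-/

set_option autoImplicit false
set_option linter.dupNamespace false

noncomputable section

open NumberField NumberField.InfinitePlace IsDedekindDomain Matrix Polynomial
open Literature.NumberTheory.Rogawski1990 Literature.NumberTheory.Automorphic Literature.NumberTheory.GaloisRepresentations
open Literature.AlgebraicGeometry.ShimuraVarieties (unitaryGroup hermForm)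
open Summit.HodgeConjecture.HodgeConjecture.Cruxes.H413.K2E4KottwitzSignParityReadings (eigenplane_anisotropic_arch_iff ncard_setOf_infinitePlace_eq_card_filter)
open Summit.HodgeConjecture.HodgeConjecture.Cruxes.H413.K2E4SingularPairArchKappaSign (im_embedding_frame_eq_zero sign_re_embedding_det_of_frame
  prod_neg_sign_det_mul_prod_archKappaSignAt_eq_neg_one_pow_ncard archCanonicalDelta_singularPair_eq archWeylRatio_singularPair_pos)
open scoped MatrixGroups ComplexConjugate Classical

namespace Summit.HodgeConjecture.HodgeConjecture.Cruxes.H413.K2E4SignedNineOfFrameExport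

section Pair

variable (L : Type) [Field L] [NumberField L] [IsCMField L] (H' : Matrix (Fin 3) (Fin 3) L)
  (hherm : (H'.map (cmConjRingHom L)).transpose = H')
  (hanis : ∀ x : Fin 3 → L, hermForm (cmConjRingHom L) H' x x = 0 → x = 0)
  (γ₀ : (UnitaryGroup.cmDatum L 3 H').Rational) {e₁ e₂ : L} (he : e₁ ≠ e₂)
  (hsplit : ((((γ₀ : unitaryGroup (cmConjRingHom L) H').val : GL (Fin 3) L) : Matrix (Fin 3) (Fin 3) L) - e₁ • (1 : Matrix (Fin 3) (Fin 3) L)) *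
      ((((γ₀ : unitaryGroup (cmConjRingHom L) H').val : GL (Fin 3) L) : Matrix (Fin 3) (Fin 3) L) - e₂ • (1 : Matrix (Fin 3) (Fin 3) L)) = 0)
  (hnc : ¬ ∃ ζ : L, (((γ₀ : unitaryGroup (cmConjRingHom L) H').val : GL (Fin 3) L) : Matrix (Fin 3) (Fin 3) L) = ζ • (1 : Matrix (Fin 3) (Fin 3) L))
  (hχ : (((γ₀ : unitaryGroup (cmConjRingHom L) H').val : GL (Fin 3) L) : Matrix (Fin 3) (Fin 3) L).charpoly =
    (Polynomial.X - Polynomial.C e₁) ^ 2 * (Polynomial.X - Polynomial.C e₂))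
  (γH : (UnitaryGroup.cmDatum L 2 (Matrix.of fun i j : Fin 2 => if i.val + j.val + 1 = 2 then (1 : L) else 0)).Rational ×
    (UnitaryGroup.cmDatum L 1 (Matrix.of fun i j : Fin 1 => if i.val + j.val + 1 = 1 then (1 : L) else 0)).Rational)
  (h1 : (((γH.1 : unitaryGroup (cmConjRingHom L) (Matrix.of fun i j : Fin 2 => if i.val + j.val + 1 = 2 then (1 : L) else 0)).val : GL (Fin 2) L) :
      Matrix (Fin 2) (Fin 2) L) = e₁ • (1 : Matrix (Fin 2) (Fin 2) L))
  (h2 : (((γH.2 : unitaryGroup (cmConjRingHom L) (Matrix.of fun i j : Fin 1 => if i.val + j.val + 1 = 1 then (1 : L) else 0)).val : GL (Fin 1) L) :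
      Matrix (Fin 1) (Fin 1) L) 0 0 = e₂)
  {P : GL (Fin 3) L} {d : Fin 3 → L} (hdσ : ∀ i, cmConjRingHom L (d i) = d i) (hd0 : ∀ i, d i ≠ 0)
  (hHP : (((P : Matrix (Fin 3) (Fin 3) L)).map (cmConjRingHom L))ᵀ * H' * (P : Matrix (Fin 3) (Fin 3) L) = Matrix.diagonal d)
  (hγP : ((((γ₀ : unitaryGroup (cmConjRingHom L) H').val : GL (Fin 3) L) : Matrix (Fin 3) (Fin 3) L)) * (P : Matrix (Fin 3) (Fin 3) L) =
    (P : Matrix (Fin 3) (Fin 3) L) * Matrix.diagonal ![e₁, e₁, e₂])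

/-! ## §1 The export's sign product is `(−1)^{#definite places}` -/

include he hdσ hd0 hHP hγP in
/-- **`(−1)^{|W|} · Π_w sgn Re σ_w(d₀ d₁) = (−1)^{#{w ∣ ∞ : W₂(γ₀) ⊗_w ℂ definite}}`** — at each complex place the `e₁`-eigenplane (columns 0, 1 of the frame, form values `d₀, d₁`)
is definite iff `0 < Re σ_w(d₀d₁)` (★ `eigenplane_anisotropic_arch_iff`), so the export's per-place sign is `+1` there and `−1` at the indefinite places; `|W| = #def + #indef`.
[cite: Rogawski1990, §8.2 p. 117; §14.6 p. 242] [cite: Kottwitz1983, §1] -/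
theorem neg_one_pow_card_mul_prod_sign_eq :
    (-1 : ℤ) ^ Fintype.card {w : InfinitePlace L // IsComplex w} *
        (∏ W : {w : InfinitePlace L // IsComplex w}, (SignType.sign ((W.1.embedding (d 0 * d 1)).re) : ℤ)) =
      (-1) ^ Set.ncard {w : InfinitePlace L |
        (∀ x : Fin 3 → ℂ,
          Matrix.mulVec (((((γ₀ : unitaryGroup (cmConjRingHom L) H').val : GL (Fin 3) L) : Matrix (Fin 3) (Fin 3) L)).map w.embedding - w.embedding e₁ • (1 : Matrix (Fin 3) (Fin 3) ℂ)) x = 0 →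
          (∑ i, ∑ j, starRingEnd ℂ (x i) * w.embedding (H' i j) * x j) = 0 → x = 0)} := by
  rw [ncard_setOf_infinitePlace_eq_card_filter, ← Finset.card_univ, ← Finset.prod_const, ← Finset.prod_mul_distrib]
  -- per place: `(−1) · sgn σ_w(d₀d₁) = if definite then −1 else 1`
  have hplace : ∀ W : {w : InfinitePlace L // IsComplex w},
      (-1 : ℤ) * (SignType.sign ((W.1.embedding (d 0 * d 1)).re) : ℤ) =
        if (∀ x : Fin 3 → ℂ,
              Matrix.mulVec (((((γ₀ : unitaryGroup (cmConjRingHom L) H').val : GL (Fin 3) L) : Matrix (Fin 3) (Fin 3) L)).map W.1.embedding - W.1.embedding e₁ • (1 : Matrix (Fin 3) (Fin 3) ℂ)) x = 0 →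
              (∑ i, ∑ j, starRingEnd ℂ (x i) * W.1.embedding (H' i j) * x j) = 0 → x = 0)
          then -1 else 1 := by
    intro W
    rw [eigenplane_anisotropic_arch_iff W.1 γ₀ he hdσ hd0 hHP hγP]
    have hre : (W.1.embedding (d 0 * d 1)).re = (W.1.embedding (d 0)).re * (W.1.embedding (d 1)).re := by
      rw [map_mul, Complex.mul_re, im_embedding_frame_eq_zero L W hdσ 0, im_embedding_frame_eq_zero L W hdσ 1, mul_zero, sub_zero]
    have hr : ∀ i, (W.1.embedding (d i)).re ≠ 0 := fun i h0 =>
      (map_ne_zero W.1.embedding).2 (hd0 i) (Complex.ext h0 (im_embedding_frame_eq_zero L W hdσ i))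
    have hne : (W.1.embedding (d 0 * d 1)).re ≠ 0 := by rw [hre]; exact mul_ne_zero (hr 0) (hr 1)
    by_cases hpos : 0 < (W.1.embedding (d 0 * d 1)).re
    · rw [if_pos hpos, sign_pos hpos]; decide
    · rw [if_neg hpos, sign_neg (lt_of_le_of_ne (not_lt.1 hpos) hne)]; decide
  rw [Finset.prod_congr rfl fun W _ => hplace W, Finset.prod_ite, Finset.prod_const, Finset.prod_const_one, mul_one]

/-! ## §2 `ε(H′)² = 1` -/

include hdσ hd0 hHP in
/-- `ε(H′)·ε(H′) = 1` for `ε(H′) = Π_w (−sgn σ_w det H′)`: in the frame `sgn σ_w(det H′) = sgn d₀ · sgn d₁ · sgn d₂` (★ `sign_re_embedding_det_of_frame`) with every `σ_w dᵢ` real and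
non-zero. [cite: Rogawski1990, §3.8 Prop. 3.8.1 (d) p. 30] -/
theorem prod_neg_sign_det_mul_self :
    (∏ W : {w : InfinitePlace L // IsComplex w}, -(SignType.sign ((W.1.embedding H'.det).re) : ℤ)) *
        (∏ W : {w : InfinitePlace L // IsComplex w}, -(SignType.sign ((W.1.embedding H'.det).re) : ℤ)) = 1 := by
  rw [← Finset.prod_mul_distrib]
  refine Finset.prod_eq_one fun W _ => ?_
  rw [sign_re_embedding_det_of_frame L H' W hdσ hHP]
  have hr : ∀ i, (W.1.embedding (d i)).re ≠ 0 := fun i h0 =>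
    (map_ne_zero W.1.embedding).2 (hd0 i) (Complex.ext h0 (im_embedding_frame_eq_zero L W hdσ i))
  have hne : ∀ i, SignType.sign ((W.1.embedding (d i)).re) ≠ 0 := fun i h => hr i (sign_eq_zero_iff.1 h)
  have key : ∀ s₀ s₁ s₂ : SignType, s₀ ≠ 0 → s₁ ≠ 0 → s₂ ≠ 0 → -((s₀ * s₁ * s₂ : SignType) : ℤ) * -((s₀ * s₁ * s₂ : SignType) : ℤ) = 1 := by decide
  exact key _ _ _ (hne 0) (hne 1) (hne 2)

/-! ## §3 The conversion: frame export ⟹ sign law -/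

include hherm hanis he hsplit hnc hχ h1 h2 hdσ hd0 hHP hγP in
/-- **FRAME EXPORT ⟹ SIGN LAW.**  For the rational semiregular `γ₀` (here: p13's `γ₀′ = P·diag(e₁,e₂,e₁)·P⁻¹`, so that ★ p855310 applies to it) with pinned frame `(P, d)`,
any `μ` (unitarity is not needed here), and a constant with the signed assembly's export shape `cinf = (−1)^{|W|} · (Π_w sgn Re σ_w(d₀d₁)) · s · conj Δ‴_∞(γ_H ⊗ 1, γ₀ ⊗ 1)`, `s > 0`:
`cinf = ε(H′) · s′ · conj τ_∞(γ_H ⊗ 1)` with `s′ = s · D_∞(γ_H ⊗ 1) > 0` — the hypothesis of ★ p855349 `explicitArchConstantPhaseSigned_of_signLaw` token for token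
(`ε(H′) = Π_w(−sgn σ_w det H′)`, `τ_∞` at `(cmRationalToArch γH.1, cmRationalToArch γH.2)`).
[cite: Rogawski1990, §8.2 Prop. 8.2.1 proof p. 119; §4.9 p. 55; §14.6 p. 242] [cite: Kottwitz1983, §1] [cite: LanglandsShelstad1987, §6.4] -/
theorem signLaw_of_frameExport (μ : HeckeCharacter L) (cinf : ℂ) (s : ℝ) (hs : 0 < s)
    (hc : cinf = (-1 : ℂ) ^ Fintype.card {w : InfinitePlace L // IsComplex w} *
        ((∏ W : {w : InfinitePlace L // IsComplex w}, (SignType.sign ((W.1.embedding (d 0 * d 1)).re) : ℤ)) : ℂ) * (s : ℂ) *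
        conj (archCanonicalDelta L H' (rationalArch L γH) μ (cmRationalToArch L 3 H' γ₀))) :
    ∃ s' : ℝ, 0 < s' ∧ cinf = ((∏ W : {w : NumberField.InfinitePlace L // NumberField.InfinitePlace.IsComplex w}, -(SignType.sign ((W.1.embedding H'.det).re) : ℤ)) : ℂ) * (s' : ℂ) *
        starRingEnd ℂ (archTau L (cmRationalToArch L 2 (Matrix.of fun i j : Fin 2 => if i.val + j.val + 1 = 2 then (1 : L) else 0) γH.1, cmRationalToArch L 1 (Matrix.of fun i j : Fin 1 => if i.val + j.val + 1 = 1 then (1 : L) else 0) γH.2) μ) := by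
  refine ⟨s * archWeylRatio L (rationalArch L γH), mul_pos hs (archWeylRatio_singularPair_pos L he γH h1 h2), ?_⟩
  have hpair : archTau L (cmRationalToArch L 2 (Matrix.of fun i j : Fin 2 => if i.val + j.val + 1 = 2 then (1 : L) else 0) γH.1, cmRationalToArch L 1 (Matrix.of fun i j : Fin 1 => if i.val + j.val + 1 = 1 then (1 : L) else 0) γH.2) μ =
      archTau L (rationalArch L γH) μ := rfl
  rw [hpair, hc, archCanonicalDelta_singularPair_eq L H' γ₀ he hsplit hχ γH h1 h2 μ]
  -- the three sign facts, cast to `ℂ`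
  have hSgn : (-1 : ℂ) ^ Fintype.card {w : InfinitePlace L // IsComplex w} *
        ((∏ W : {w : InfinitePlace L // IsComplex w}, (SignType.sign ((W.1.embedding (d 0 * d 1)).re) : ℤ)) : ℂ) =
      (-1) ^ Set.ncard {w : InfinitePlace L |
        (∀ x : Fin 3 → ℂ,
          Matrix.mulVec (((((γ₀ : unitaryGroup (cmConjRingHom L) H').val : GL (Fin 3) L) : Matrix (Fin 3) (Fin 3) L)).map w.embedding - w.embedding e₁ • (1 : Matrix (Fin 3) (Fin 3) ℂ)) x = 0 →
          (∑ i, ∑ j, starRingEnd ℂ (x i) * w.embedding (H' i j) * x j) = 0 → x = 0)} := by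
    have h := congrArg (fun z : ℤ => (z : ℂ)) (neg_one_pow_card_mul_prod_sign_eq L H' γ₀ he hdσ hd0 hHP hγP)
    simpa only [Int.cast_mul, Int.cast_pow, Int.cast_neg, Int.cast_one, Int.cast_prod] using h
  have hG := congrArg (fun z : ℤ => (z : ℂ)) (prod_neg_sign_det_mul_prod_archKappaSignAt_eq_neg_one_pow_ncard L H' hherm hanis γ₀ he hsplit hnc hχ γH h1 h2)
  simp only [Int.cast_mul, Int.cast_pow, Int.cast_neg, Int.cast_one, Int.cast_prod] at hG
  have hε := congrArg (fun z : ℤ => (z : ℂ)) (prod_neg_sign_det_mul_self L H' hdσ hd0 hHP)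
  simp only [Int.cast_mul, Int.cast_one, Int.cast_neg, Int.cast_prod] at hε
  have hM : ((-1 : ℂ) ^ Set.ncard {w : InfinitePlace L |
        (∀ x : Fin 3 → ℂ,
          Matrix.mulVec (((((γ₀ : unitaryGroup (cmConjRingHom L) H').val : GL (Fin 3) L) : Matrix (Fin 3) (Fin 3) L)).map w.embedding - w.embedding e₁ • (1 : Matrix (Fin 3) (Fin 3) ℂ)) x = 0 →
          (∑ i, ∑ j, starRingEnd ℂ (x i) * w.embedding (H' i j) * x j) = 0 → x = 0)}) *
      ((-1 : ℂ) ^ Set.ncard {w : InfinitePlace L |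
        (∀ x : Fin 3 → ℂ,
          Matrix.mulVec (((((γ₀ : unitaryGroup (cmConjRingHom L) H').val : GL (Fin 3) L) : Matrix (Fin 3) (Fin 3) L)).map w.embedding - w.embedding e₁ • (1 : Matrix (Fin 3) (Fin 3) ℂ)) x = 0 →
          (∑ i, ∑ j, starRingEnd ℂ (x i) * w.embedding (H' i j) * x j) = 0 → x = 0)}) = 1 := by
    rw [← mul_pow, neg_one_mul, neg_neg, one_pow]
  -- conjugation of the closed form `τ · D · K` (`D` real, `K` an integer)
  rw [hSgn, map_mul, map_mul, Complex.conj_ofReal, Complex.ofReal_mul]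
  have hK : conj ((∏ W : {w : InfinitePlace L // IsComplex w}, archKappaSignAt L H' (rationalArch L γH) W (cmRationalToArch L 3 H' γ₀) : ℤ) : ℂ) =
      ((∏ W : {w : InfinitePlace L // IsComplex w}, archKappaSignAt L H' (rationalArch L γH) W (cmRationalToArch L 3 H' γ₀) : ℤ) : ℂ) := map_intCast _ _
  rw [hK]
  simp only [Int.cast_prod]
  linear_combination
    ((s : ℂ) * (archWeylRatio L (rationalArch L γH) : ℂ) * conj (archTau L (rationalArch L γH) μ) *
        ((∏ W : {w : NumberField.InfinitePlace L // NumberField.InfinitePlace.IsComplex w}, -(SignType.sign ((W.1.embedding H'.det).re) : ℤ)) : ℂ) *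
        (-1 : ℂ) ^ Set.ncard {w : InfinitePlace L |
          (∀ x : Fin 3 → ℂ,
            Matrix.mulVec (((((γ₀ : unitaryGroup (cmConjRingHom L) H').val : GL (Fin 3) L) : Matrix (Fin 3) (Fin 3) L)).map w.embedding - w.embedding e₁ • (1 : Matrix (Fin 3) (Fin 3) ℂ)) x = 0 →
            (∑ i, ∑ j, starRingEnd ℂ (x i) * w.embedding (H' i j) * x j) = 0 → x = 0)}) * hG +
      (-((s : ℂ) * (archWeylRatio L (rationalArch L γH) : ℂ) * conj (archTau L (rationalArch L γH) μ) *
        ((-1 : ℂ) ^ Set.ncard {w : InfinitePlace L |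
          (∀ x : Fin 3 → ℂ,
            Matrix.mulVec (((((γ₀ : unitaryGroup (cmConjRingHom L) H').val : GL (Fin 3) L) : Matrix (Fin 3) (Fin 3) L)).map w.embedding - w.embedding e₁ • (1 : Matrix (Fin 3) (Fin 3) ℂ)) x = 0 →
            (∑ i, ∑ j, starRingEnd ℂ (x i) * w.embedding (H' i j) * x j) = 0 → x = 0)}) *
        (∏ W : {w : InfinitePlace L // IsComplex w}, ((archKappaSignAt L H' (rationalArch L γH) W (cmRationalToArch L 3 H' γ₀) : ℤ) : ℂ)))) * hε +
      ((s : ℂ) * (archWeylRatio L (rationalArch L γH) : ℂ) * conj (archTau L (rationalArch L γH) μ) *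
        ((∏ W : {w : NumberField.InfinitePlace L // NumberField.InfinitePlace.IsComplex w}, -(SignType.sign ((W.1.embedding H'.det).re) : ℤ)) : ℂ)) * hM

end Pair

end Summit.HodgeConjecture.HodgeConjecture.Cruxes.H413.K2E4SignedNineOfFrameExport

end
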